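import Summits.NavierStokesRegularity.NavierStokesRegularity.Theorems.PerpetualPumpAveragedTypeIBlowupPulseTools
import Mathlib.Analysis.SpecialFunctions.Pow.Real
import Mathlib.Analysis.Complex.ExponentialBounds

/-!
# Crux `PerpetualPump.AveragedTypeIBlowup` (stmt-NavierStokesRegularity-1835), line `Sketch`:
# stub `pulseBoot` — regime numerics and the sizes of the front's forcings

First file of the proof of the registered stub `stub_pulseBoot` (the pulse-phase bootstrap of the
window one-step theorem; Mathlib-only mathematics). Elementary numerics of the regime during the
truncated transfer pulse: the pulse horizon `σ_P = (5 log B' + 20)/B' ≤ 1/10` (`pulseBoot_sigmaP`,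
= registered tools sub-goal `stub_pulseBootRegime`), the astronomically small seed
`ε̄ (b_hi+4)^k ≤ e^{-1000}` (`pulseBoot_seed`) and the resulting negligible loose size
`Y₁ = e^{25} ε̄ (b_hi+4)⁸` of the next bond (`pulseBoot_Y`), powers of `q = √(1+ε₀)`
(`pulseBoot_sizes`), absolute-value bookkeeping, and the pointwise sizes of the front's forcing
brackets (`pulseBoot_front_brackets`) and of the three forcings of the front's Toda gate
(`pulseBoot_front_forcings`, all `≤ 1/2000`).

## References

T. Tao, *Finite time blowup for an averaged three-dimensional Navier–Stokes equation*, J. Amer.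
Math. Soc. 29 (2016), 601–674, §5–6 (the cascade / transfer-pulse heuristics); the content here is
folklore ODE calculus (comparison, Duhamel bounds, continuous induction).
-/

noncomputable section

-- the summit namespace `…NavierStokesRegularity.NavierStokesRegularity…` is the tree convention
set_option linter.dupNamespace false

open Set Filter Topology

namespace Summit.NavierStokesRegularity.NavierStokesRegularity.Theorems.PerpetualPumpAveragedTypeIBlowup

/-- **The truncated pulse horizon is short**: for `x ≥ 10⁴`, `0 ≤ log x`, `5 log x + 20 ≤ x/10`
(`log x ≤ x/10⁴ + 33/4`), so `σ_P = (5 log x + 20)/x ∈ (0, 1/10]`. [folklore] -/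
theorem pulseBoot_sigmaP {x : ℝ} (hx : 10 ^ 4 ≤ x) :
    0 ≤ Real.log x ∧ 5 * Real.log x + 20 ≤ x / 10 ∧ 0 < (5 * Real.log x + 20) / x ∧
    (5 * Real.log x + 20) / x ≤ 1 / 10 := by
  have hx0 : 0 < x := lt_of_lt_of_le (by norm_num) hx
  have hlog0 : 0 ≤ Real.log x := Real.log_nonneg (le_trans (by norm_num) hx)
  have hlog := pulse_log_le hx
  have h2 : 5 * Real.log x + 20 ≤ x / 10 := by linarith
  refine ⟨hlog0, h2, div_pos (by linarith) hx0, ?_⟩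
  rw [div_le_iff₀ hx0]
  linarith

/-- `e^{-900} ≤ 10⁻⁶` (`e ≥ 2`, `2^{900} ≥ 10⁶`). [folklore] -/
theorem pulseBoot_exp_neg900 : Real.exp (-900) ≤ 1 / 10 ^ 6 := by
  have h1 : (2 : ℝ) ≤ Real.exp 1 := by
    have := Real.add_one_le_exp (1 : ℝ)
    linarith
  have h2 : (2 : ℝ) ^ 20 ≤ Real.exp 1 ^ 20 := pow_le_pow_left₀ (by norm_num) h1 20
  have h3 : Real.exp 1 ^ 20 = Real.exp 20 := by rw [← Real.exp_nat_mul]; norm_num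
  have h4 : (10 : ℝ) ^ 6 ≤ 2 ^ 20 := by norm_num
  have h5 : Real.exp 20 ≤ Real.exp 900 := Real.exp_le_exp.2 (by norm_num)
  rw [Real.exp_neg, one_div]
  exact inv_anti₀ (by positivity) (by linarith)

/-- **The seed is astronomically small in the regime**: from
`10³ + 20 log(b_hi+5) + log(F+2) ≤ −log ε̄` (`F ≥ 0`, `b_hi + 4 ≥ 1`):
`ε̄ (b_hi+4)^k ≤ e^{−1000}` for every `k ≤ 20`. [folklore] -/
theorem pulseBoot_seed {εb F bhi : ℝ} (hεb : 0 < εb) (hF : 0 ≤ F) (hbhi : 1 ≤ bhi + 4)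
    (hseed : 10 ^ 3 + 20 * Real.log (bhi + 5) + Real.log (F + 2) ≤ -Real.log εb) :
    ∀ k : ℕ, k ≤ 20 → εb * (bhi + 4) ^ k ≤ Real.exp (-1000) := by
  intro k hk
  have hb5 : 0 < bhi + 5 := by linarith
  have hlogF : 0 ≤ Real.log (F + 2) := Real.log_nonneg (by linarith)
  have h1 : Real.log (εb * (bhi + 5) ^ 20) ≤ -1000 := by
    rw [Real.log_mul hεb.ne' (by positivity), Real.log_pow]
    push_cast
    linarith
  have h2 : εb * (bhi + 5) ^ 20 ≤ Real.exp (-1000) := by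
    have := Real.exp_le_exp.2 h1
    rwa [Real.exp_log (by positivity)] at this
  have h3 : (bhi + 4) ^ k ≤ (bhi + 5) ^ 20 :=
    calc (bhi + 4) ^ k ≤ (bhi + 4) ^ 20 := pow_le_pow_right₀ hbhi hk
      _ ≤ (bhi + 5) ^ 20 := pow_le_pow_left₀ (by linarith) (by linarith) 20
  calc εb * (bhi + 4) ^ k ≤ εb * (bhi + 5) ^ 20 := mul_le_mul_of_nonneg_left h3 hεb.le
    _ ≤ Real.exp (-1000) := h2

/-- **The loose size `Y₁ = e^{25} ε̄ (b_hi+4)⁸` of the next bond during the pulse is negligible**: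
`Y₁ > 0`, `2Y₁ ≤ 1/100`, `Y₁ ≤ 10⁻³`, `20 Y₁² ≤ ε̄` (so `(2Y₁)² ≤ ε̄/5` feeds the ladder),
`ε̄ ≤ Y₁`, and `3 Y₁ (b_hi + 5) ≤ 10⁻³`. [folklore] -/
theorem pulseBoot_Y {εb F bhi : ℝ} (hεb : 0 < εb) (hF : 0 ≤ F) (hbhi : 1 ≤ bhi + 4)
    (hseed : 10 ^ 3 + 20 * Real.log (bhi + 5) + Real.log (F + 2) ≤ -Real.log εb) :
    0 < Real.exp 25 * εb * (bhi + 4) ^ 8 ∧ 2 * (Real.exp 25 * εb * (bhi + 4) ^ 8) ≤ 1 / 100 ∧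
    Real.exp 25 * εb * (bhi + 4) ^ 8 ≤ 1 / 10 ^ 3 ∧
    20 * (Real.exp 25 * εb * (bhi + 4) ^ 8) ^ 2 ≤ εb ∧ εb ≤ Real.exp 25 * εb * (bhi + 4) ^ 8 ∧
    3 * (Real.exp 25 * εb * (bhi + 4) ^ 8) * (bhi + 5) ≤ 1 / 10 ^ 3 := by
  have hs := pulseBoot_seed hεb hF hbhi hseed
  have h8 := hs 8 (by norm_num)
  have h9 := hs 9 (by norm_num)
  have h16 := hs 16 (by norm_num)
  have hE := pulseBoot_exp_neg900
  have hp : 0 < Real.exp 25 := Real.exp_pos _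
  have e25 : Real.exp 25 * Real.exp (-1000) ≤ Real.exp (-900) := by
    rw [← Real.exp_add]
    exact Real.exp_le_exp.2 (by norm_num)
  have e50 : Real.exp 25 ^ 2 * Real.exp (-1000) ≤ Real.exp (-900) := by
    rw [← Real.exp_nat_mul, ← Real.exp_add]
    exact Real.exp_le_exp.2 (by norm_num)
  have hY8 : Real.exp 25 * εb * (bhi + 4) ^ 8 ≤ Real.exp (-900) := by
    rw [mul_assoc]
    exact (mul_le_mul_of_nonneg_left h8 hp.le).trans e25
  have hY9 : Real.exp 25 * εb * (bhi + 4) ^ 8 * (bhi + 4) ≤ Real.exp (-900) := by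
    have e1 : Real.exp 25 * εb * (bhi + 4) ^ 8 * (bhi + 4) = Real.exp 25 * (εb * (bhi + 4) ^ 9) := by
      ring
    rw [e1]
    exact (mul_le_mul_of_nonneg_left h9 hp.le).trans e25
  have hY16 : Real.exp 25 ^ 2 * (εb * (bhi + 4) ^ 16) ≤ Real.exp (-900) :=
    (mul_le_mul_of_nonneg_left h16 (by positivity)).trans e50
  have hY0 : 0 < Real.exp 25 * εb * (bhi + 4) ^ 8 := by positivity
  refine ⟨hY0, by linarith, by linarith, ?_, ?_, ?_⟩
  · have e1 : (Real.exp 25 * εb * (bhi + 4) ^ 8) ^ 2 =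
        (Real.exp 25 ^ 2 * (εb * (bhi + 4) ^ 16)) * εb := by ring
    rw [e1]
    nlinarith
  · have h1 : 1 ≤ Real.exp 25 := by
      have := Real.add_one_le_exp (25 : ℝ)
      linarith
    have h2 : 1 ≤ (bhi + 4) ^ 8 := one_le_pow₀ hbhi
    have h3 : (1 : ℝ) * 1 ≤ Real.exp 25 * (bhi + 4) ^ 8 := mul_le_mul h1 h2 zero_le_one hp.le
    have : εb * 1 ≤ εb * (Real.exp 25 * (bhi + 4) ^ 8) :=
      mul_le_mul_of_nonneg_left (by linarith) hεb.le
    linarith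
  · have h1 : bhi + 5 ≤ 2 * (bhi + 4) := by linarith
    have h2 : 3 * (Real.exp 25 * εb * (bhi + 4) ^ 8) * (bhi + 5) ≤
        3 * (Real.exp 25 * εb * (bhi + 4) ^ 8) * (2 * (bhi + 4)) :=
      mul_le_mul_of_nonneg_left h1 (by positivity)
    nlinarith

/-- **Elementary sizes in the regime** (`ε̄(b_hi+4)³ ≤ 10⁻⁹`, `ε̄(b_hi+4)² ≤ 10⁻⁹`, and the powers
of `q = √(1+ε₀)`: `q⁴ ∈ [1, 111/100]`, `q³ ∈ [1, 116/100]`, `q⁵ ≤ 116/100`, `0 < q`). [folklore] -/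
theorem pulseBoot_sizes {ε₀ εb F bhi q : ℝ} (hε₀ : 0 < ε₀) (hε₀' : ε₀ ≤ 1 / 20) (hεb : 0 < εb)
    (hF0 : 0 ≤ F) (hbhi : 1 ≤ bhi + 4) (hεbreg : εb * (10 ^ 9 * (F + 1) ^ 2 * (bhi + 4) ^ 3) ≤ 1)
    (hq : q = Real.sqrt (1 + ε₀)) :
    εb * (bhi + 4) ^ 3 ≤ 1 / 10 ^ 9 ∧ εb * (bhi + 4) ^ 2 ≤ 1 / 10 ^ 9 ∧
    1 ≤ q ^ 4 ∧ q ^ 4 ≤ 111 / 100 ∧ 1 ≤ q ^ 3 ∧ q ^ 3 ≤ 116 / 100 ∧ q ^ 5 ≤ 116 / 100 ∧ 0 < q ∧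
    1 ≤ q ∧ q ≤ 21 / 20 := by
  have ha : (0 : ℝ) < 1 + ε₀ := by linarith
  have hq2 : q ^ 2 = 1 + ε₀ := by rw [hq, Real.sq_sqrt ha.le]
  have hq0 : 0 < q := by rw [hq]; exact Real.sqrt_pos.2 ha
  have hq1 : 1 ≤ q := by rw [hq]; exact Real.one_le_sqrt.2 (by linarith)
  have hq21 : q ≤ 21 / 20 := by rw [hq, Real.sqrt_le_left (by norm_num)]; nlinarith
  have hq4 : q ^ 4 = (1 + ε₀) ^ 2 := by rw [show q ^ 4 = (q ^ 2) ^ 2 by ring, hq2]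
  have hq4hi : q ^ 4 ≤ 111 / 100 := by rw [hq4]; nlinarith
  have hq4lo : 1 ≤ q ^ 4 := one_le_pow₀ hq1
  have hq3lo : 1 ≤ q ^ 3 := one_le_pow₀ hq1
  have hq3hi : q ^ 3 ≤ 116 / 100 := by
    have : q ^ 3 ≤ q ^ 4 := pow_le_pow_right₀ hq1 (by norm_num)
    linarith
  have hq5 : q ^ 5 ≤ 116 / 100 := by
    have e : q ^ 5 = q ^ 4 * q := by ring
    rw [e]
    nlinarith
  have hF1 : (1 : ℝ) ≤ (F + 1) ^ 2 := by nlinarith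
  have h3 : εb * (bhi + 4) ^ 3 ≤ 1 / 10 ^ 9 := by
    have h1 : εb * (bhi + 4) ^ 3 * 10 ^ 9 ≤ εb * (10 ^ 9 * (F + 1) ^ 2 * (bhi + 4) ^ 3) := by
      have e : εb * (10 ^ 9 * (F + 1) ^ 2 * (bhi + 4) ^ 3) =
          εb * (bhi + 4) ^ 3 * 10 ^ 9 * (F + 1) ^ 2 := by ring
      rw [e]
      exact le_mul_of_one_le_right (by positivity) hF1
    rw [le_div_iff₀ (by norm_num)]
    linarith
  have h2 : εb * (bhi + 4) ^ 2 ≤ 1 / 10 ^ 9 := by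
    have : εb * (bhi + 4) ^ 2 ≤ εb * (bhi + 4) ^ 3 :=
      mul_le_mul_of_nonneg_left (pow_le_pow_right₀ hbhi (by norm_num)) hεb.le
    linarith
  exact ⟨h3, h2, hq4lo, hq4hi, hq3lo, hq3hi, hq5, hq0, hq1, hq21⟩

/-- `|a - b + c|, |a + c|, `|-(a) + c|`, `|a - b - c| ≤ A + B + C` from `|a| ≤ A`, `|b| ≤ B`,
`|c| ≤ C`. [folklore] -/
theorem pulseBoot_abs3 {a b c A B C : ℝ} (ha : |a| ≤ A) (hb : |b| ≤ B) (hc : |c| ≤ C) :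
    |a - b + c| ≤ A + B + C ∧ |a + c| ≤ A + B + C ∧ |-a + c| ≤ A + B + C ∧
    |a - b - c| ≤ A + B + C := by
  have ha' := abs_le.1 ha
  have hb' := abs_le.1 hb
  have hc' := abs_le.1 hc
  have hB : 0 ≤ B := (abs_nonneg _).trans hb
  refine ⟨abs_le.2 ⟨by linarith, by linarith⟩, abs_le.2 ⟨by linarith, by linarith⟩,
    abs_le.2 ⟨by linarith, by linarith⟩, abs_le.2 ⟨by linarith, by linarith⟩⟩

/-- `|x * y| ≤ X * Y` and `|e * x * y| ≤ e * X * Y` (`e > 0`) from `|x| ≤ X`, `|y| ≤ Y`. [folklore] -/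
theorem pulseBoot_abs_mul {x y X Y e : ℝ} (he : 0 < e) (hx : |x| ≤ X) (hy : |y| ≤ Y) :
    |x * y| ≤ X * Y ∧ |e * x * y| ≤ e * X * Y := by
  have h1 : |x * y| ≤ X * Y := by
    rw [abs_mul]
    exact mul_le_mul hx hy (abs_nonneg _) ((abs_nonneg _).trans hx)
  refine ⟨h1, ?_⟩
  rw [mul_assoc, abs_mul, abs_of_pos he, mul_assoc]
  exact mul_le_mul_of_nonneg_left h1 he.le

set_option maxHeartbeats 400000 in
/-- **Pointwise size of the front's forcing brackets during the pulse**: with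
`|b_n|, |w_n|, |b_{n+1}/q| ≤ B' + 1/100 ≤ b_hi + 2.51`, `|w_{n−1}| ≤ 1/100`, `ε̄ (b_hi+4)² ≤ 10⁻⁹`:
`|G0 n| ≤ (b_hi+3)²` and `|G1 n| ≤ 2(b_hi + 13/5)²`. [folklore] -/
theorem pulseBoot_front_brackets {b w b1 wl εb q bhi Bp : ℝ} (hεb : 0 < εb)
    (hεb2 : εb * (bhi + 4) ^ 2 ≤ 1 / 10 ^ 9) (hq1 : 1 ≤ q) (hBp : Bp + 1 / 100 ≤ bhi + 251 / 100)
    (hb : |b| ≤ Bp + 1 / 100) (hw : |w| ≤ Bp + 1 / 100) (hβ : |b1 / q| ≤ Bp + 1 / 100)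
    (hwl : |wl| ≤ 1 / 100) :
    |wl ^ 2 / q ^ 3 - w ^ 2 - εb * b * w| ≤ (bhi + 3) ^ 2 ∧
    |w * (b - b1 / q) + εb * b ^ 2| ≤ 2 * (bhi + 13 / 5) ^ 2 := by
  set X := bhi + 251 / 100 with hX
  have hX0 : 0 ≤ X := le_trans ((abs_nonneg b).trans hb) hBp
  have hbX : |b| ≤ X := hb.trans hBp
  have hwX : |w| ≤ X := hw.trans hBp
  have hβX : |b1 / q| ≤ X := hβ.trans hBp
  have hX4 : X ≤ bhi + 4 := by rw [hX]; linarith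
  have hεX : εb * X * X ≤ 1 / 10 ^ 9 := by
    have : εb * X * X ≤ εb * (bhi + 4) ^ 2 := by
      rw [mul_assoc, ← sq]
      exact mul_le_mul_of_nonneg_left (pow_le_pow_left₀ hX0 hX4 2) hεb.le
    linarith
  have hwl2 : wl ^ 2 / q ^ 3 ≤ 1 / 10 ^ 4 := by
    refine (div_le_self (sq_nonneg _) (one_le_pow₀ hq1)).trans ?_
    have := abs_le.1 hwl
    nlinarith
  have hwl0 : 0 ≤ wl ^ 2 / q ^ 3 := div_nonneg (sq_nonneg _) (by positivity)
  have hw2 : w ^ 2 ≤ X * X := by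
    have := abs_le.1 hwX
    nlinarith
  obtain ⟨-, hbw⟩ := pulseBoot_abs_mul hεb hbX hwX
  have hbw' := abs_le.1 hbw
  constructor
  · rw [abs_le]
    have e : (bhi + 3) ^ 2 = X * X + 98 / 100 * X + 2401 / 10000 := by rw [hX]; ring
    rw [e]
    constructor <;> nlinarith [sq_nonneg w]
  · have h1 : |w * (b - b1 / q)| ≤ X * (X + X) := by
      rw [abs_mul]
      refine mul_le_mul hwX ((abs_sub _ _).trans (by linarith)) (abs_nonneg _) hX0
    have h1' := abs_le.1 h1
    have h2 : εb * b ^ 2 ≤ 1 / 10 ^ 9 := by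
      have : b ^ 2 ≤ X * X := by
        have := abs_le.1 hbX
        nlinarith
      nlinarith
    have h3 : 0 ≤ εb * b ^ 2 := by positivity
    rw [abs_le]
    have e : 2 * (bhi + 13 / 5) ^ 2 = 2 * (X * X) + 36 / 100 * X + 162 / 10000 := by rw [hX]; ring
    rw [e]
    constructor <;> nlinarith

/-- **Sizes of the three forcings of the front's gate during the pulse** (pointwise): with the
loose bounds `|w_{n−1}| ≤ 1/100`, `|b_n|, |w_n| ≤ 2(b_hi+4)`, `M0 n ≤ 6(b_hi+4)²`,
`M1 n ≤ 10(b_hi+4)²`, `|b_{n+1}| ≤ 3(b_hi+4)`, `|w_{n+1}| ≤ 2Y₁ ≤ 1/100`, `M0 (n+1) ≤ 3B` and the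
memory residuals `|e₀| ≤ η M0 n`, `|e₁| ≤ η M1 n`, `|e₀'| ≤ η q⁴ M0 (n+1)`, the forcings
`f₁ = w_{n−1}²/q³ − ε̄ b w + e₀`, `f₂ = ε̄ b² + e₁`, `f₃ = −q³(w_{n+1}² + ε̄ b_{n+1} w_{n+1}) + e₀'/q`
are `≤ 1/2000` in size (`ε̄(b_hi+4)² ≤ 10⁻⁹`, `η(b_hi+4)² ≤ 10⁻⁹`). [folklore] -/
theorem pulseBoot_front_forcings {εb η q bhi B Y₁ wl b w M0n M1n b1 w1 M0n1 e0 e1 e01 : ℝ}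
    (hεb : 0 < εb) (hη : 0 ≤ η) (hεb2 : εb * (bhi + 4) ^ 2 ≤ 1 / 10 ^ 9)
    (hη1 : η * (bhi + 4) ≤ 1 / 10 ^ 9) (hη2 : η * (bhi + 4) ^ 2 ≤ 1 / 10 ^ 9) (hbhi : 1 ≤ bhi + 4)
    (hBhi : B ≤ bhi) (hB : 0 ≤ B) (hq0 : 0 < q) (hq1 : 1 ≤ q) (hq3lo : 1 ≤ q ^ 3)
    (hq3hi : q ^ 3 ≤ 116 / 100) (hq4hi : q ^ 4 ≤ 111 / 100) (hY' : 2 * Y₁ ≤ 1 / 100)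
    (l1 : |wl| ≤ 1 / 100) (l2 : |b| ≤ 2 * (bhi + 4)) (l3 : |w| ≤ 2 * (bhi + 4))
    (l4 : M0n ≤ 6 * (bhi + 4) ^ 2) (l5 : M1n ≤ 10 * (bhi + 4) ^ 2) (l6 : |b1| ≤ 3 * (bhi + 4))
    (l7 : |w1| ≤ 2 * Y₁) (l8 : M0n1 ≤ 3 * B)
    (e0b : |e0| ≤ η * 1 * M0n) (e1b : |e1| ≤ η * 1 * M1n) (e01b : |e01| ≤ η * q ^ 4 * M0n1) :
    |wl ^ 2 / q ^ 3 - εb * b * w + e0| ≤ 1 / 2000 ∧ |εb * b ^ 2 + e1| ≤ 1 / 2000 ∧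
    |-(q ^ 3 * (w1 ^ 2 + εb * b1 * w1)) + e01 / q| ≤ 1 / 2000 := by
  -- f₁
  have a1 : |wl ^ 2 / q ^ 3| ≤ 1 / 10 ^ 4 := by
    rw [abs_of_nonneg (div_nonneg (sq_nonneg _) (by positivity))]
    refine (div_le_self (sq_nonneg _) hq3lo).trans ?_
    have h := pow_le_pow_left₀ (abs_nonneg _) l1 2
    rw [sq_abs] at h
    exact h.trans (by norm_num)
  obtain ⟨-, a2⟩ := pulseBoot_abs_mul hεb l2 l3
  have a2' : |εb * b * w| ≤ 4 / 10 ^ 9 := by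
    refine a2.trans ?_
    have e : εb * (2 * (bhi + 4)) * (2 * (bhi + 4)) = 4 * (εb * (bhi + 4) ^ 2) := by ring
    rw [e]
    linarith
  have a3 : |e0| ≤ 6 / 10 ^ 9 := by
    refine e0b.trans ?_
    rw [mul_one]
    calc η * M0n ≤ η * (6 * (bhi + 4) ^ 2) := mul_le_mul_of_nonneg_left l4 hη
      _ = 6 * (η * (bhi + 4) ^ 2) := by ring
      _ ≤ 6 / 10 ^ 9 := by linarith
  obtain ⟨f1, -, -, -⟩ := pulseBoot_abs3 a1 a2' a3
  -- f₂
  have b1' : |εb * b ^ 2| ≤ 4 / 10 ^ 9 := by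
    rw [abs_of_nonneg (by positivity)]
    have e : εb * b ^ 2 = εb * b * b := by ring
    obtain ⟨-, a2b⟩ := pulseBoot_abs_mul hεb l2 l2
    have e2 : εb * (2 * (bhi + 4)) * (2 * (bhi + 4)) = 4 * (εb * (bhi + 4) ^ 2) := by ring
    rw [e]
    linarith [(abs_le.1 a2b).2]
  have b3 : |e1| ≤ 10 / 10 ^ 9 := by
    refine e1b.trans ?_
    rw [mul_one]
    calc η * M1n ≤ η * (10 * (bhi + 4) ^ 2) := mul_le_mul_of_nonneg_left l5 hη
      _ = 10 * (η * (bhi + 4) ^ 2) := by ring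
      _ ≤ 10 / 10 ^ 9 := by linarith
  obtain ⟨-, f2, -, -⟩ := pulseBoot_abs3 b1' a2' b3
  -- f₃
  have c1 : |q ^ 3 * (w1 ^ 2 + εb * b1 * w1)| ≤ 2 / 10 ^ 4 := by
    rw [abs_mul, abs_of_pos (by positivity)]
    have hY2 : w1 ^ 2 ≤ 1 / 10 ^ 4 := by
      have h := pow_le_pow_left₀ (abs_nonneg _) (l7.trans hY') 2
      rw [sq_abs] at h
      exact h.trans (by norm_num)
    obtain ⟨-, c12⟩ := pulseBoot_abs_mul hεb l6 (l7.trans hY')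
    have c12' : |εb * b1 * w1| ≤ 3 / 10 ^ 11 := by
      refine c12.trans ?_
      have e : εb * (3 * (bhi + 4)) * (1 / 100) = 3 / 100 * (εb * (bhi + 4)) := by ring
      rw [e]
      have : εb * (bhi + 4) ≤ εb * (bhi + 4) ^ 2 :=
        mul_le_mul_of_nonneg_left (le_self_pow₀ hbhi two_ne_zero) hεb.le
      linarith only [this, hεb2]
    have c13 : |w1 ^ 2 + εb * b1 * w1| ≤ 1 / 10 ^ 4 + 3 / 10 ^ 11 := by
      refine (abs_add_le _ _).trans ?_
      rw [abs_of_nonneg (sq_nonneg _)]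
      linarith only [hY2, c12']
    calc q ^ 3 * |w1 ^ 2 + εb * b1 * w1| ≤ 116 / 100 * (1 / 10 ^ 4 + 3 / 10 ^ 11) :=
          mul_le_mul hq3hi c13 (abs_nonneg _) (by norm_num)
      _ ≤ 2 / 10 ^ 4 := by norm_num
  have c3 : |e01 / q| ≤ 4 / 10 ^ 9 := by
    rw [abs_div, abs_of_pos hq0]
    refine (div_le_self (abs_nonneg _) hq1).trans (e01b.trans ?_)
    have h1 : η * q ^ 4 * M0n1 ≤ η * q ^ 4 * (3 * B) := mul_le_mul_of_nonneg_left l8 (by positivity)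
    have h2 : η * B ≤ 1 / 10 ^ 9 := by
      have : η * B ≤ η * (bhi + 4) := mul_le_mul_of_nonneg_left (by linarith) hη
      linarith
    have h3 : η * q ^ 4 * (3 * B) = 3 * q ^ 4 * (η * B) := by ring
    rw [h3] at h1
    have h4 : 3 * q ^ 4 * (η * B) ≤ 3 * (111 / 100) * (1 / 10 ^ 9) :=
      mul_le_mul (by linarith only [hq4hi]) h2 (mul_nonneg hη hB) (by positivity)
    linarith only [h1, h4]
  obtain ⟨-, -, f3, -⟩ := pulseBoot_abs3 c1 a2' c3
  exact ⟨f1.trans (by norm_num), f2.trans (by norm_num), f3.trans (by norm_num)⟩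


/-- **Registered tools sub-goal `stub_pulseBootRegime`** of the stub `pulseBoot` (line `Sketch`,
crux stmt-NavierStokesRegularity-1835): in the regime the seed is astronomically small,
`ε̄ (b_hi+4)^k ≤ e^{−1000}` for `k ≤ 20` (`pulseBoot_seed`). [folklore] -/
theorem stub_pulseBootRegime :
    ∀ (εb F bhi : ℝ) (k : ℕ), 0 < εb → 0 ≤ F → 1 ≤ bhi + 4 →
      10 ^ 3 + 20 * Real.log (bhi + 5) + Real.log (F + 2) ≤ -Real.log εb → k ≤ 20 →
      εb * (bhi + 4) ^ k ≤ Real.exp (-1000) :=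
  fun _ _ _ k hεb hF hbhi hseed hk => pulseBoot_seed hεb hF hbhi hseed k hk

end Summit.NavierStokesRegularity.NavierStokesRegularity.Theorems.PerpetualPumpAveragedTypeIBlowup

end
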